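/-
HarnessLib — harness support library: tag attributes (D-0006). Imports `Lean` only, so it builds in seconds and every
Literature/Summits file can `import HarnessLib.Attr` (or `import HarnessLib`). (Was `lean/Millennium/Attr.lean`,
namespace `Millennium`, until the 2026-08-14 Summits rename, D-0022.)
-/
import Lean

/-!
# HarnessLib tag attributes

* `@[cite "BibKey" "Thm 1.2"]` — the declaration restates a PUBLISHED result; `BibKey` must be a key of
  `lean/references.bib` (the gate checks textually). Second argument (locator) optional.
* `@[folklore]` — standard material with no single citable source.
* `@[claim "Key" "under-review"]` — an unrefereed claim (`under-review` | `disputed`); a cite for the lints, counted separately (D-0012).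
* `@[cite_pending]` — citation still to be found (migration-only; counted as UNVERIFIED trust base).
* `@[problem "rh"]` — a problem statement / named variant belonging to family id `rh` (see harness/gate/families.py).
* `@[target "rh.S07"]` — the declaration is acceptance-suite target `rh.S07`.
* `@[summit "parity"]`, `@[subsummit "parity.imp1"]`, `@[open_rel]` (docstring `[open]`) — summit files (D-0007).

All four only RECORD `(declName, attrName, args)` in a persistent environment extension; `#harness_tags Foo.bar`
prints what was recorded for a declaration (the gate can query it through a probe file). The docstring forms
`[cite: Key, Thm 1.2]`, `[folklore]`, `[problem: rh]`, `[target: rh.S07]` and the interim `**rh.S07**` marker are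
equivalent for the gate's textual lints and the views' counters.
-/

open Lean Elab Command

namespace HarnessLib

/-- One recorded tag: declaration, attribute name, string arguments. -/
structure TagEntry where
  decl : Name
  attr : Name
  args : Array String
  deriving Inhabited, Repr

/-- Persistent store of all tags in the environment (imported entries concatenated, then local ones). -/
initialize tagExt : SimplePersistentEnvExtension TagEntry (Array TagEntry) ←
  registerSimplePersistentEnvExtension {
    addEntryFn := Array.push
    addImportedFn := fun arrs => arrs.foldl (· ++ ·) #[]
  }

/-- All tags recorded for `decl` in `env`. -/
def tagsOf (env : Environment) (decl : Name) : Array TagEntry :=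
  (tagExt.getState env).filter (·.decl == decl)

/-- `@[cite "BibKey" "locator"?]` — published source of a vendored statement. -/
syntax (name := cite) "cite " str (ppSpace str)? : attr
/-- `@[claim "BibKey" "under-review"]` — an UNREFEREED claim (status `under-review` or `disputed`); lint-wise a cite,
counted separately (D-0012). -/
syntax (name := claim) "claim " str ppSpace str : attr
/-- `@[folklore]` — standard material without a single citable source. -/
syntax (name := folklore) "folklore" : attr
/-- `@[cite_pending]` — vendored statement whose citation is still to be found (migration-only; the gate accepts it
from operator/migrator roles and opens a librarian work item). -/
syntax (name := cite_pending) "cite_pending" : attr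
/-- `@[problem "familyId"]` — problem statement / variant of a family. -/
syntax (name := problem) "problem " str : attr
/-- `@[target "fam.Snn"]` — acceptance-suite target marker. -/
syntax (name := target) "target " str : attr
/-- `@[summit "parity"]` — the summit (peak conjunction) of a family, in `Summits/<Summit>/Statement.lean` (D-0007/D-0017). -/
syntax (name := summit) "summit " str : attr
/-- `@[subsummit "parity.imp1"]` — a relation theorem (implication/instance) inside a summit file. -/
syntax (name := subsummit) "subsummit " str : attr
/-- `@[open_rel]` — the relation is an OPEN problem stated with `sorry` on purpose (docstring form: `[open]`). -/
syntax (name := open_rel) "open_rel" : attr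

private def record (decl attr : Name) (args : Array String) : AttrM Unit :=
  modifyEnv fun env => tagExt.addEntry env { decl, attr, args }

initialize registerBuiltinAttribute {
  name := `cite
  descr := "published source: @[cite \"BibKey\" \"Thm 1.2\"]"
  applicationTime := .afterTypeChecking
  add := fun decl stx _kind => do
    match stx with
    | `(attr| cite $k:str $[$loc:str]?) =>
        record decl `cite (#[k.getString] ++ (match loc with | some l => #[l.getString] | none => #[]))
    | _ => throwError "malformed @[cite]: expected @[cite \"BibKey\" \"locator\"?]"
}

initialize registerBuiltinAttribute {
  name := `folklore
  descr := "standard material without a single citable source"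
  applicationTime := .afterTypeChecking
  add := fun decl _stx _kind => record decl `folklore #[]
}

initialize registerBuiltinAttribute {
  name := `claim
  descr := "unrefereed claim: @[claim \"BibKey\" \"under-review\"|\"disputed\"]"
  applicationTime := .afterTypeChecking
  add := fun decl stx _kind => do
    match stx with
    | `(attr| claim $k:str $st:str) => record decl `claim #[k.getString, st.getString]
    | _ => throwError "malformed @[claim]: expected @[claim \"BibKey\" \"under-review\"]"
}

initialize registerBuiltinAttribute {
  name := `cite_pending
  descr := "citation still to be found (migration-only)"
  applicationTime := .afterTypeChecking
  add := fun decl _stx _kind => record decl `cite_pending #[]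
}

initialize registerBuiltinAttribute {
  name := `problem
  descr := "problem statement / variant of family: @[problem \"rh\"]"
  applicationTime := .afterTypeChecking
  add := fun decl stx _kind => do
    match stx with
    | `(attr| problem $f:str) => record decl `problem #[f.getString]
    | _ => throwError "malformed @[problem]: expected @[problem \"familyId\"]"
}

initialize registerBuiltinAttribute {
  name := `target
  descr := "acceptance-suite target: @[target \"rh.S07\"]"
  applicationTime := .afterTypeChecking
  add := fun decl stx _kind => do
    match stx with
    | `(attr| target $t:str) => record decl `target #[t.getString]
    | _ => throwError "malformed @[target]: expected @[target \"fam.Snn\"]"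
}

initialize registerBuiltinAttribute {
  name := `summit
  descr := "family summit: @[summit \"parity\"]"
  applicationTime := .afterTypeChecking
  add := fun decl stx _kind => do
    match stx with
    | `(attr| summit $f:str) => record decl `summit #[f.getString]
    | _ => throwError "malformed @[summit]: expected @[summit \"familyId\"]"
}

initialize registerBuiltinAttribute {
  name := `subsummit
  descr := "summit relation: @[subsummit \"parity.imp1\"]"
  applicationTime := .afterTypeChecking
  add := fun decl stx _kind => do
    match stx with
    | `(attr| subsummit $f:str) => record decl `subsummit #[f.getString]
    | _ => throwError "malformed @[subsummit]: expected @[subsummit \"id\"]"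
}

initialize registerBuiltinAttribute {
  name := `open_rel
  descr := "open relation stated with sorry on purpose"
  applicationTime := .afterTypeChecking
  add := fun decl _stx _kind => record decl `open #[]
}

/-- Print every tag recorded for `n`, one `HARNESSTAG <decl> <attr> <args>` line each. -/
def printTags (n : Name) : CommandElabM Unit := do
  let ts := tagsOf (← getEnv) n
  if ts.isEmpty then
    logInfo m!"HARNESSTAG {n} (none)"
  else
    for t in ts do
      logInfo m!"HARNESSTAG {n} {t.attr} {t.args}"

/-- `#harness_tags Foo.bar` prints every tag recorded for `Foo.bar`. -/
elab "#harness_tags " id:ident : command => do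
  printTags (← liftCoreM <| realizeGlobalConstNoOverloadWithInfo id)

/-! ## Unused-variables linter: named binders of `∀` telescopes are statement text (D-0014)

Named facts spell their hypotheses as named binders of a `∀` telescope, exactly as a theorem
signature would: `def X : Prop := ∀ {ε : ℝ} (hε : 0 < ε) (t : ℝ), …` (D-0014; prompts: "hypotheses
complete, statement as printed"). The conclusion never references a proof-irrelevant hypothesis
name, so core's `linter.unusedVariables` reported every such binder (3 754 warnings in the
2026-08-14 inventory, `docs/maintenance/rename-2026-08-14.md` §4) although core itself exempts the
arrow spelling `(hε : 0 < ε) → …` (its builtin `depArrow` ignore function). This extends that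
exemption to bracketed binders sitting directly under `∀`. It is deliberately narrow: binders of
declaration signatures, `fun`, `intro`/`obtain`/`rcases` patterns, `have`/`let`, `match` arms and
`∃` are linted exactly as before (maintenance 2026-08-14, `harness/ops/maint/fix_unused_vars.py`). -/

/-- Ignore unused *named* binders `(h : P)`, `{x : α}`, `⦃x : α⦄` of a `∀` telescope (statement-level
hypothesis names of D-0014 named facts), like core's `depArrow` exemption of `(h : P) → Q`. -/
@[unused_variables_ignore_fn]
def ignoreForallBinder : Lean.Linter.IgnoreFunction := fun _ stack _ =>
  stack.matches [`null, ``Lean.Parser.Term.explicitBinder, `null, ``Lean.Parser.Term.forall] ||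
  stack.matches [`null, ``Lean.Parser.Term.implicitBinder, `null, ``Lean.Parser.Term.forall] ||
  stack.matches [`null, ``Lean.Parser.Term.strictImplicitBinder, `null, ``Lean.Parser.Term.forall]

end HarnessLib
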